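import Mathlib
import Summits.NavierStokesRegularity.NavierStokesRegularity.Theorems.FilamentSkeletonRssDefectColumnGateDefs
import Summits.NavierStokesRegularity.NavierStokesRegularity.Theorems.FilamentSkeletonRssKelvinGateClosingPicard

/-!
# Route `FilamentSkeletonRss` · crux `TransverseReduction1AG` (stmt-27853) · line of record `defect_column_gate_1AG` — STUB S3b
# `stub_defectContinuity1AG : DefectContinuity1AG` (continuity of the defect coefficient on the rate window)

LEAD of 27853 (lane ns-filament-21221-p1 g9), 2026-08-28; `--supports stmt-NavierStokesRegularity-27853` (registered stub, by name).
HONEST FRAMING: the TOPOLOGICAL half of the closing step of a HYPOTHETICAL filament-type rotating-self-similar blow-up route (MODEL rung,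
negative side); nothing here bears on Navier–Stokes regularity; `TransverseReduction1AG` is neither proved nor refuted.

Claim.  For a re-wound family (`FamilySpec1AG`), a defect gate around it (`DefectGateSpec1AG`) in the contraction regime
`64(C₂Γ^κ)²(C_rΓ^{-k}) ≤ 1`, and any family `β ↦ G_β` of frozen-rate fixed points `G_β = −r_β − D(𝓚_βG_β)[𝓚_βG_β]` with `Y(G_β) ≤ 2ε`
(`ε = C_rΓ^{-k}`), the scalar `β ↦ 𝓫_β G_β` is continuous on `[−β₀, β₀]`.
Proof.  (i) `G_β` is the limit of the Picard iterates `P_β^n` (from `0`), with `Y(G_β − P_β^n) ≤ 2ε/2ⁿ` UNIFORMLY in `β`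
(`KelvinGate.picard_contracts`).  (ii) Each iterate is LOCALLY continuous in `β` (sup on balls), by induction on `n`: the `(n+1)`-st
difference is `−(r_β' − r_β) − [D(𝓚'F')𝓚'F' − D(𝓚F)𝓚F]`, controlled on a ball by the family's local continuity of `r`, the gate's local
continuity (4) (`𝓚_β'F` vs `𝓚_βF`, values and derivatives) and the gate's TIGHTNESS (3) (`𝓚_β'd`, `D𝓚_β'd` small on the ball once
`d = F' − F` is small on a larger ball — the induction hypothesis); a finite regress of balls for each `n`.  (iii)
`|b_β' − b_β| ≤ |𝓫_β'(G_β' − P_β'^n)| + |𝓫_β'(P_β'^n − P_β^n)| + |(𝓫_β' − 𝓫_β)P_β^n| + |𝓫_β(P_β^n − G_β)|`: the outer terms are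
`≤ C₂Γ^κ·2ε/2ⁿ` (gate bound (1) + linearity (2)), the third is small by (4), the second by (3) with (ii).
-/

set_option linter.dupNamespace false

noncomputable section

namespace Summit.NavierStokesRegularity.NavierStokesRegularity.Theorems.DefectColumnGate

open scoped BigOperators Topology InnerProductSpace ContDiff
open Filter Set Function MeasureTheory
open Literature.Analysis.FluidPDE
open Summit.NavierStokesRegularity.NavierStokesRegularity.Theses.FilamentSkeletonRss
open Summit.NavierStokesRegularity.NavierStokesRegularity.Theorems.KelvinGate

/-! ## Picard iterates of the frozen-rate map and their distance to a fixed point -/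

section Picard

variable {K : (EuclideanSpace ℝ (Fin 3) → EuclideanSpace ℝ (Fin 3)) → EuclideanSpace ℝ (Fin 3) → EuclideanSpace ℝ (Fin 3)} {A ε : ℝ}
  {r : EuclideanSpace ℝ (Fin 3) → EuclideanSpace ℝ (Fin 3)}

/-- The Picard iterates from `0` of `F ↦ −r − D(KF)[KF]`. -/
def picardIter (K : (EuclideanSpace ℝ (Fin 3) → EuclideanSpace ℝ (Fin 3)) → EuclideanSpace ℝ (Fin 3) → EuclideanSpace ℝ (Fin 3))
    (r : EuclideanSpace ℝ (Fin 3) → EuclideanSpace ℝ (Fin 3)) (n : ℕ) : EuclideanSpace ℝ (Fin 3) → EuclideanSpace ℝ (Fin 3) :=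
  (fun F => fun y => -r y - fderiv ℝ (K F) y (K F y))^[n] (fun _ => 0)

/-- The zeroth iterate is `0`. -/
theorem picardIter_zero : picardIter K r 0 = fun _ => 0 := rfl

/-- The recursion `P_{n+1} = −r − D(K Pₙ)[K Pₙ]`. -/
theorem picardIter_succ (n : ℕ) :
    picardIter K r (n + 1) = fun y => -r y - fderiv ℝ (K (picardIter K r n)) y (K (picardIter K r n) y) :=
  Function.iterate_succ_apply' _ n _

/-- The iterates stay in the ball `Y ≤ 2ε`. -/
theorem picardIter_bound
    (hK1 : ∀ (F : EuclideanSpace ℝ (Fin 3) → EuclideanSpace ℝ (Fin 3)) (R : ℝ), YBound F R → XBound (K F) (A * R))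
    (hK2 : ∀ (F G : EuclideanSpace ℝ (Fin 3) → EuclideanSpace ℝ (Fin 3)) (s : ℝ), (∃ R, YBound F R) →
      (∃ R, YBound G R) → K (fun y => F y + s • G y) = fun y => K F y + s • K G y)
    (hr : YBound r ε) (hA : 16 * A ^ 2 * ε ≤ 1) (n : ℕ) : YBound (picardIter K r n) (2 * ε) :=
  (picard_seq_bounds hK1 hK2 hr hA (Fs := picardIter K r) picardIter_zero picardIter_succ n).1

/-- **Uniform geometric approximation of any fixed point in the ball by the iterates**: `Y(G − Pₙ) ≤ 2ε/2ⁿ`. -/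
theorem fixedPoint_sub_picardIter
    (hK1 : ∀ (F : EuclideanSpace ℝ (Fin 3) → EuclideanSpace ℝ (Fin 3)) (R : ℝ), YBound F R → XBound (K F) (A * R))
    (hK2 : ∀ (F G : EuclideanSpace ℝ (Fin 3) → EuclideanSpace ℝ (Fin 3)) (s : ℝ), (∃ R, YBound F R) →
      (∃ R, YBound G R) → K (fun y => F y + s • G y) = fun y => K F y + s • K G y)
    (hr : YBound r ε) (hA : 16 * A ^ 2 * ε ≤ 1) {G : EuclideanSpace ℝ (Fin 3) → EuclideanSpace ℝ (Fin 3)}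
    (hG : YBound G (2 * ε)) (hfix : ∀ y, G y = -r y - fderiv ℝ (K G) y (K G y)) (n : ℕ) :
    YBound (fun y => G y - picardIter K r n y) (2 * ε / 2 ^ n) := by
  induction n with
  | zero =>
    simp only [picardIter_zero, sub_zero, pow_zero, div_one]
    exact hG
  | succ n ih =>
    have hP := picardIter_bound hK1 hK2 hr hA n
    have h := picard_contracts hK1 hK2 hr hA hG hP ih
    have e : (fun y => G y - picardIter K r (n + 1) y) =
        fun y => (-r y - fderiv ℝ (K G) y (K G y)) - (-r y - fderiv ℝ (K (picardIter K r n)) y (K (picardIter K r n) y)) := by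
      funext y; rw [picardIter_succ, ← hfix y]
    rw [e]
    refine h.mono (le_of_eq ?_)
    rw [pow_succ]; ring

end Picard

/-! ## Small operator-norm bookkeeping -/

/-- `‖(L − L′) v‖ ≤ ‖L − L′‖ ‖v‖` in the form `‖L v − L′ v‖ ≤ …`. -/
theorem norm_clm_sub_apply_le (L L' : EuclideanSpace ℝ (Fin 3) →L[ℝ] EuclideanSpace ℝ (Fin 3)) (v : EuclideanSpace ℝ (Fin 3)) :
    ‖L v - L' v‖ ≤ ‖L - L'‖ * ‖v‖ :=
  calc ‖L v - L' v‖ = ‖(L - L') v‖ := rfl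
    _ ≤ ‖L - L'‖ * ‖v‖ := (L - L').le_opNorm v

/-! ## The stub -/

/-- **STUB S3b `DefectContinuity1AG` OF LINE `defect_column_gate_1AG`, PROVED** (registered signature, by name). -/
theorem stub_defectContinuity1AG : DefectContinuity1AG := by
  intro N Γ ρ η Rw Rb θ₀ k Cs Cr q₁ κ C₂ α X u α0 β₀ U0 P0 Z g r hfam 𝓚 𝓠 𝓫 hgate hsmall G hG
  obtain ⟨hβ₀, -, -, -, -, -, hmem, hfamc⟩ := hfam
  obtain ⟨hg1, htight, hgc⟩ := hgate
  -- shorthand constants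
  have hres : ∀ β, |β| ≤ β₀ → YBound (r β) (Cr * Γ ^ (-(k:ℝ))) := fun β hβ => (hmem β hβ).2.2.2.2.2.2.2.2.2.2.1
  have habsβ₀ : |β₀| ≤ β₀ := by rw [abs_of_pos hβ₀]
  have hε0 : 0 ≤ Cr * Γ ^ (-(k:ℝ)) := (hres β₀ habsβ₀).nonneg
  have hK1 : ∀ β, |β| ≤ β₀ → ∀ (F : EuclideanSpace ℝ (Fin 3) → EuclideanSpace ℝ (Fin 3)) (R : ℝ), YBound F R →
      XBound (𝓚 β F) (C₂ * Γ ^ κ * R) := fun β hβ F R hF => ((hg1 β hβ).1 F R hF).1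
  have hK2 : ∀ β, |β| ≤ β₀ → ∀ (F G : EuclideanSpace ℝ (Fin 3) → EuclideanSpace ℝ (Fin 3)) (s : ℝ), (∃ R, YBound F R) →
      (∃ R, YBound G R) → 𝓚 β (fun y => F y + s • G y) = fun y => 𝓚 β F y + s • 𝓚 β G y :=
    fun β hβ F G s hF hG => ((hg1 β hβ).2 F G s hF hG).1
  have hb2 : ∀ β, |β| ≤ β₀ → ∀ (F G : EuclideanSpace ℝ (Fin 3) → EuclideanSpace ℝ (Fin 3)) (s : ℝ), (∃ R, YBound F R) →
      (∃ R, YBound G R) → 𝓫 β (fun y => F y + s • G y) = 𝓫 β F + s * 𝓫 β G :=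
    fun β hβ F G s hF hG => ((hg1 β hβ).2 F G s hF hG).2
  have hbB : ∀ β, |β| ≤ β₀ → ∀ (F : EuclideanSpace ℝ (Fin 3) → EuclideanSpace ℝ (Fin 3)) (R : ℝ), YBound F R →
      |𝓫 β F| ≤ C₂ * Γ ^ κ * R := fun β hβ F R hF => ((hg1 β hβ).1 F R hF).2.2.2.1
  have hA0 : 0 ≤ C₂ * Γ ^ κ := by
    have h := (hK1 β₀ habsβ₀ (fun _ => 0) 1 (yBound_zero.mono zero_le_one)).nonneg
    linarith
  have h16 : 16 * (C₂ * Γ ^ κ) ^ 2 * (Cr * Γ ^ (-(k:ℝ))) ≤ 1 := by nlinarith [sq_nonneg (C₂ * Γ ^ κ)]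
  -- the Picard iterates at each rate
  have hPb : ∀ β, |β| ≤ β₀ → ∀ n, YBound (picardIter (𝓚 β) (r β) n) (2 * (Cr * Γ ^ (-(k:ℝ)))) :=
    fun β hβ n => picardIter_bound (hK1 β hβ) (hK2 β hβ) (hres β hβ) h16 n
  have hdist : ∀ β, |β| ≤ β₀ → ∀ n, YBound (fun y => G β y - picardIter (𝓚 β) (r β) n y) (2 * (Cr * Γ ^ (-(k:ℝ))) / 2 ^ n) :=
    fun β hβ n => fixedPoint_sub_picardIter (hK1 β hβ) (hK2 β hβ) (hres β hβ) h16 (hG β hβ).1 (hG β hβ).2 n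
  -- `𝓫_β F − 𝓫_β F′ = 𝓫_β (F − F′)`
  have hbsub : ∀ β, |β| ≤ β₀ → ∀ (F F' : EuclideanSpace ℝ (Fin 3) → EuclideanSpace ℝ (Fin 3)) (R R' : ℝ), YBound F R → YBound F' R' →
      𝓫 β F - 𝓫 β F' = 𝓫 β (fun y => F y - F' y) := by
    intro β hβ F F' R R' hF hF'
    have hd : YBound (fun y => F y - F' y) (R + R') := hF.sub hF'
    have e : (fun y => F' y + (1:ℝ) • (fun z => F z - F' z) y) = F := by funext y; simp
    have h := hb2 β hβ F' (fun z => F z - F' z) 1 ⟨R', hF'⟩ ⟨R + R', hd⟩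
    rw [e] at h
    rw [h]; ring
  -- LOCAL CONTINUITY OF THE ITERATES in `β` (finite regress of balls)
  have hloc : ∀ n : ℕ, ∀ β, |β| ≤ β₀ → ∀ L t : ℝ, 0 < t → ∃ δ > 0, ∀ β', |β'| ≤ β₀ → |β' - β| < δ →
      ∀ y, ‖y‖ ≤ L → ‖picardIter (𝓚 β') (r β') n y - picardIter (𝓚 β) (r β) n y‖ ≤ t := by
    intro n
    induction n with
    | zero =>
      intro β hβ L t ht
      refine ⟨1, one_pos, fun β' _ _ y _ => ?_⟩
      simp only [picardIter_zero, sub_self, norm_zero]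
      exact ht.le
    | succ n ih =>
      intro β hβ L t ht
      -- the radius of the gate's outputs on the `2ε`-ball
      have ha0 : 0 ≤ C₂ * Γ ^ κ * (2 * (Cr * Γ ^ (-(k:ℝ)))) := by positivity
      obtain ⟨a, ha, ha0'⟩ : ∃ a : ℝ, a = C₂ * Γ ^ κ * (2 * (Cr * Γ ^ (-(k:ℝ)))) ∧ 0 ≤ a := ⟨_, rfl, ha0⟩
      have he₄0 : 0 < t / (3 * (2 * a + 1)) := by positivity
      have hFY : YBound (picardIter (𝓚 β) (r β) n) (2 * (Cr * Γ ^ (-(k:ℝ)))) := hPb β hβ n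
      -- gate clause (4) at the datum `Pₙ(β)`, target `e₄` on the ball `L`
      obtain ⟨δ₄, hδ₄, h4⟩ := hgc β hβ (picardIter (𝓚 β) (r β) n) _ L (t / (3 * (2 * a + 1))) hFY he₄0
      -- gate tightness (3) for differences (`Y ≤ 4ε`), target `e₄` on the ball `L`
      obtain ⟨L', δ₀, hδ₀, h3⟩ := htight (2 * (Cr * Γ ^ (-(k:ℝ))) + 2 * (Cr * Γ ^ (-(k:ℝ)))) L (t / (3 * (2 * a + 1))) he₄0
      -- induction hypothesis on the larger ball
      obtain ⟨δn, hδn, hn⟩ := ih β hβ L' δ₀ hδ₀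
      -- the family's local continuity of the residual
      obtain ⟨δr, hδr, hrc⟩ := hfamc β hβ L (t / 3) (by positivity)
      refine ⟨min δn (min δ₄ δr), lt_min hδn (lt_min hδ₄ hδr), fun β' hβ' hd y hy => ?_⟩
      have hd1 : |β' - β| < δn := lt_of_lt_of_le hd (min_le_left _ _)
      have hd4 : |β' - β| < δ₄ := lt_of_lt_of_le hd ((min_le_right _ _).trans (min_le_left _ _))
      have hdr : |β' - β| < δr := lt_of_lt_of_le hd ((min_le_right _ _).trans (min_le_right _ _))
      have hF'Y : YBound (picardIter (𝓚 β') (r β') n) (2 * (Cr * Γ ^ (-(k:ℝ)))) := hPb β' hβ' n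
      -- the difference of the `n`-th iterates and its smallness on `L′`
      have hdY : YBound (fun z => picardIter (𝓚 β') (r β') n z - picardIter (𝓚 β) (r β) n z)
          (2 * (Cr * Γ ^ (-(k:ℝ))) + 2 * (Cr * Γ ^ (-(k:ℝ)))) := hF'Y.sub hFY
      have hdsmall : ∀ z, ‖z‖ ≤ L' → ‖picardIter (𝓚 β') (r β') n z - picardIter (𝓚 β) (r β) n z‖ ≤ δ₀ :=
        fun z hz => hn β' hβ' hd1 z hz
      obtain ⟨h3K, -⟩ := h3 β' hβ' _ hdY hdsmall
      obtain ⟨h4K, -⟩ := h4 β' hβ' hd4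
      have hrr : ‖r β' y - r β y‖ ≤ t / 3 := (hrc β' hβ' hdr).2.2.1 y hy
      -- `𝓚_β′ Pₙ(β′) = 𝓚_β′ Pₙ(β) + 𝓚_β′ d`
      have hKsplit : 𝓚 β' (picardIter (𝓚 β') (r β') n) = fun z => 𝓚 β' (picardIter (𝓚 β) (r β) n) z +
          𝓚 β' (fun z => picardIter (𝓚 β') (r β') n z - picardIter (𝓚 β) (r β) n z) z := by
        have e : (fun z => picardIter (𝓚 β) (r β) n z + (1:ℝ) • (fun z => picardIter (𝓚 β') (r β') n z - picardIter (𝓚 β) (r β) n z) z) =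
            picardIter (𝓚 β') (r β') n := by funext z; simp
        have h := hK2 β' hβ' (picardIter (𝓚 β) (r β) n) (fun z => picardIter (𝓚 β') (r β') n z - picardIter (𝓚 β) (r β) n z) 1
          ⟨_, hFY⟩ ⟨_, hdY⟩
        rw [e] at h
        rw [h]; funext z; simp
      -- X-bounds and pointwise sizes
      have hXF : XBound (𝓚 β' (picardIter (𝓚 β) (r β) n)) a := by rw [ha]; exact hK1 β' hβ' _ _ hFY
      have hXFβ : XBound (𝓚 β (picardIter (𝓚 β) (r β) n)) a := by rw [ha]; exact hK1 β hβ _ _ hFY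
      have hXF' : XBound (𝓚 β' (picardIter (𝓚 β') (r β') n)) a := by rw [ha]; exact hK1 β' hβ' _ _ hF'Y
      have hXd : XBound (𝓚 β' (fun z => picardIter (𝓚 β') (r β') n z - picardIter (𝓚 β) (r β) n z))
          (C₂ * Γ ^ κ * (2 * (Cr * Γ ^ (-(k:ℝ))) + 2 * (Cr * Γ ^ (-(k:ℝ))))) := hK1 β' hβ' _ _ hdY
      obtain ⟨hv1, hD1⟩ := hXF.norm_le' y
      obtain ⟨hv2, hD2⟩ := hXFβ.norm_le' y
      obtain ⟨hv3, hD3⟩ := hXF'.norm_le' y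
      obtain ⟨hKd, hDKd⟩ := h3K y hy
      obtain ⟨h4v, h4D⟩ := h4K y hy
      -- the `(n+1)`-st difference
      rw [picardIter_succ, picardIter_succ]
      simp only
      have hDsplit : fderiv ℝ (𝓚 β' (picardIter (𝓚 β') (r β') n)) y = fderiv ℝ (𝓚 β' (picardIter (𝓚 β) (r β) n)) y +
          fderiv ℝ (𝓚 β' (fun z => picardIter (𝓚 β') (r β') n z - picardIter (𝓚 β) (r β) n z)) y := by
        rw [hKsplit]
        exact fderiv_fun_add (hXF.1.differentiable (by norm_num) y) (hXd.1.differentiable (by norm_num) y)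
      have hvsplit : 𝓚 β' (picardIter (𝓚 β') (r β') n) y = 𝓚 β' (picardIter (𝓚 β) (r β) n) y +
          𝓚 β' (fun z => picardIter (𝓚 β') (r β') n z - picardIter (𝓚 β) (r β) n z) y := by rw [hKsplit]
      -- the four pieces
      set K'F := 𝓚 β' (picardIter (𝓚 β) (r β) n) with hK'F
      set KF := 𝓚 β (picardIter (𝓚 β) (r β) n) with hKF
      set K'F' := 𝓚 β' (picardIter (𝓚 β') (r β') n) with hK'F'
      set K'd := 𝓚 β' (fun z => picardIter (𝓚 β') (r β') n z - picardIter (𝓚 β) (r β) n z) with hK'd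
      have eT : fderiv ℝ K'F' y (K'F' y) - fderiv ℝ KF y (KF y) =
          fderiv ℝ K'd y (K'F' y) + fderiv ℝ K'F y (K'd y) + (fderiv ℝ K'F y (K'F y) - fderiv ℝ KF y (K'F y)) +
            fderiv ℝ KF y (K'F y - KF y) := by
        rw [hDsplit, hvsplit]
        simp only [_root_.add_apply, map_add, map_sub]
        abel
      have hT1 : ‖fderiv ℝ K'd y (K'F' y)‖ ≤ t / (3 * (2 * a + 1)) * a :=
        (ContinuousLinearMap.le_opNorm _ _).trans (mul_le_mul hDKd hv3 (norm_nonneg _) he₄0.le)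
      have hT2 : ‖fderiv ℝ K'F y (K'd y)‖ ≤ a * (t / (3 * (2 * a + 1))) :=
        (ContinuousLinearMap.le_opNorm _ _).trans (mul_le_mul hD1 hKd (norm_nonneg _) ha0')
      have hT3 : ‖fderiv ℝ K'F y (K'F y) - fderiv ℝ KF y (K'F y)‖ ≤ t / (3 * (2 * a + 1)) * a :=
        (norm_clm_sub_apply_le _ _ _).trans (mul_le_mul h4D hv1 (norm_nonneg _) he₄0.le)
      have hT4 : ‖fderiv ℝ KF y (K'F y - KF y)‖ ≤ a * (t / (3 * (2 * a + 1))) :=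
        (ContinuousLinearMap.le_opNorm _ _).trans (mul_le_mul hD2 h4v (norm_nonneg _) ha0')
      have hsum : ‖fderiv ℝ K'F' y (K'F' y) - fderiv ℝ KF y (KF y)‖ ≤ 4 * a * (t / (3 * (2 * a + 1))) := by
        rw [eT]
        calc _ ≤ ‖fderiv ℝ K'd y (K'F' y) + fderiv ℝ K'F y (K'd y) + (fderiv ℝ K'F y (K'F y) - fderiv ℝ KF y (K'F y))‖ +
              ‖fderiv ℝ KF y (K'F y - KF y)‖ := norm_add_le _ _
          _ ≤ (‖fderiv ℝ K'd y (K'F' y) + fderiv ℝ K'F y (K'd y)‖ + ‖fderiv ℝ K'F y (K'F y) - fderiv ℝ KF y (K'F y)‖) +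
              ‖fderiv ℝ KF y (K'F y - KF y)‖ := by gcongr; exact norm_add_le _ _
          _ ≤ ((‖fderiv ℝ K'd y (K'F' y)‖ + ‖fderiv ℝ K'F y (K'd y)‖) + ‖fderiv ℝ K'F y (K'F y) - fderiv ℝ KF y (K'F y)‖) +
              ‖fderiv ℝ KF y (K'F y - KF y)‖ := by gcongr; exact norm_add_le _ _
          _ ≤ ((t / (3 * (2 * a + 1)) * a + a * (t / (3 * (2 * a + 1)))) + t / (3 * (2 * a + 1)) * a) + a * (t / (3 * (2 * a + 1))) := by
              gcongr
          _ = 4 * a * (t / (3 * (2 * a + 1))) := by ring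
      -- `4a·e₄ ≤ 2t/3`
      have hfrac : 4 * a * (t / (3 * (2 * a + 1))) ≤ 2 * t / 3 := by
        have hpos : 0 < 3 * (2 * a + 1) := by positivity
        rw [show 4 * a * (t / (3 * (2 * a + 1))) = (4 * a * t) / (3 * (2 * a + 1)) by ring, div_le_iff₀ hpos]
        nlinarith [ha0', ht.le]
      calc ‖-r β' y - fderiv ℝ K'F' y (K'F' y) - (-r β y - fderiv ℝ KF y (KF y))‖
          = ‖-(r β' y - r β y) - (fderiv ℝ K'F' y (K'F' y) - fderiv ℝ KF y (KF y))‖ := by congr 1; abel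
        _ ≤ ‖-(r β' y - r β y)‖ + ‖fderiv ℝ K'F' y (K'F' y) - fderiv ℝ KF y (KF y)‖ := norm_sub_le _ _
        _ ≤ t / 3 + 2 * t / 3 := by rw [norm_neg]; exact add_le_add hrr (hsum.trans hfrac)
        _ = t := by ring
  -- CONTINUITY of `β ↦ 𝓫_β G_β` on the closed window
  rw [Metric.continuousOn_iff]
  intro β hβW t ht
  have hβ : |β| ≤ β₀ := abs_le.mpr ⟨hβW.1, hβW.2⟩
  -- choose the truncation `n`: `C₂Γ^κ · (2ε/2ⁿ) ≤ t/8`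
  obtain ⟨n, hn⟩ : ∃ n : ℕ, 16 * (C₂ * Γ ^ κ) * (Cr * Γ ^ (-(k:ℝ))) / t < (2:ℝ) ^ n :=
    pow_unbounded_of_one_lt _ one_lt_two
  have hpow : (0:ℝ) < 2 ^ n := by positivity
  have htail : C₂ * Γ ^ κ * (2 * (Cr * Γ ^ (-(k:ℝ))) / 2 ^ n) ≤ t / 8 := by
    have h1 : 16 * (C₂ * Γ ^ κ) * (Cr * Γ ^ (-(k:ℝ))) < t * 2 ^ n := by
      have := (div_lt_iff₀ ht).mp hn; linarith
    rw [show C₂ * Γ ^ κ * (2 * (Cr * Γ ^ (-(k:ℝ))) / 2 ^ n) = (2 * (C₂ * Γ ^ κ) * (Cr * Γ ^ (-(k:ℝ)))) / 2 ^ n by ring,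
      div_le_iff₀ hpow]
    linarith
  -- (3) for the `𝓫`-part of the difference of the `n`-th iterates, target `t/8`
  obtain ⟨L', δ₀, hδ₀, h3⟩ := htight (2 * (Cr * Γ ^ (-(k:ℝ))) + 2 * (Cr * Γ ^ (-(k:ℝ)))) 0 (t / 8) (by positivity)
  obtain ⟨δn, hδn, hnloc⟩ := hloc n β hβ L' δ₀ hδ₀
  -- (4) at the datum `Pₙ(β)`, target `t/8`
  obtain ⟨δ₄, hδ₄, h4⟩ := hgc β hβ (picardIter (𝓚 β) (r β) n) _ 0 (t / 8) (hPb β hβ n) (by positivity)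
  refine ⟨min δn δ₄, lt_min hδn hδ₄, fun β' hβ'W hd => ?_⟩
  have hβ' : |β'| ≤ β₀ := abs_le.mpr ⟨hβ'W.1, hβ'W.2⟩
  rw [Real.dist_eq] at hd ⊢
  have hd1 : |β' - β| < δn := lt_of_lt_of_le hd (min_le_left _ _)
  have hd4 : |β' - β| < δ₄ := lt_of_lt_of_le hd (min_le_right _ _)
  -- the four pieces
  have p1 : |𝓫 β' (G β') - 𝓫 β' (picardIter (𝓚 β') (r β') n)| ≤ t / 8 := by
    rw [hbsub β' hβ' _ _ _ _ (hG β' hβ').1 (hPb β' hβ' n)]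
    exact (hbB β' hβ' _ _ (hdist β' hβ' n)).trans htail
  have p4 : |𝓫 β (picardIter (𝓚 β) (r β) n) - 𝓫 β (G β)| ≤ t / 8 := by
    rw [abs_sub_comm, hbsub β hβ _ _ _ _ (hG β hβ).1 (hPb β hβ n)]
    exact (hbB β hβ _ _ (hdist β hβ n)).trans htail
  have p2 : |𝓫 β' (picardIter (𝓚 β') (r β') n) - 𝓫 β' (picardIter (𝓚 β) (r β) n)| ≤ t / 8 := by
    rw [hbsub β' hβ' _ _ _ _ (hPb β' hβ' n) (hPb β hβ n)]
    exact (h3 β' hβ' _ ((hPb β' hβ' n).sub (hPb β hβ n)) (fun z hz => hnloc β' hβ' hd1 z hz)).2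
  have p3 : |𝓫 β' (picardIter (𝓚 β) (r β) n) - 𝓫 β (picardIter (𝓚 β) (r β) n)| ≤ t / 8 := (h4 β' hβ' hd4).2
  calc |𝓫 β' (G β') - 𝓫 β (G β)|
      = |(𝓫 β' (G β') - 𝓫 β' (picardIter (𝓚 β') (r β') n)) + (𝓫 β' (picardIter (𝓚 β') (r β') n) - 𝓫 β' (picardIter (𝓚 β) (r β) n)) +
          (𝓫 β' (picardIter (𝓚 β) (r β) n) - 𝓫 β (picardIter (𝓚 β) (r β) n)) + (𝓫 β (picardIter (𝓚 β) (r β) n) - 𝓫 β (G β))| := by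
        congr 1; ring
    _ ≤ |𝓫 β' (G β') - 𝓫 β' (picardIter (𝓚 β') (r β') n)| + |𝓫 β' (picardIter (𝓚 β') (r β') n) - 𝓫 β' (picardIter (𝓚 β) (r β) n)| +
          |𝓫 β' (picardIter (𝓚 β) (r β) n) - 𝓫 β (picardIter (𝓚 β) (r β) n)| + |𝓫 β (picardIter (𝓚 β) (r β) n) - 𝓫 β (G β)| := by
        refine (abs_add_le _ _).trans ?_
        refine add_le_add ((abs_add_le _ _).trans (add_le_add (abs_add_le _ _) le_rfl)) le_rfl
    _ ≤ t / 8 + t / 8 + t / 8 + t / 8 := by gcongr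
    _ < t := by linarith

end Summit.NavierStokesRegularity.NavierStokesRegularity.Theorems.DefectColumnGate

end
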